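import Summits.BirchSwinnertonDyer.Rank1Residual.GaloisImage.PadicTwistClassDecider
import Summits.BirchSwinnertonDyer.Rank1Residual.GaloisImage.LocalThreeTorsionAdicCompletionAt
import Mathlib.Algebra.Polynomial.Degree.SmallDegree
import Literature.NumberTheory.EllipticCurves.CongruenceVisibilityMultiplicativeTwisted
import Literature.NumberTheory.EllipticCurves.HondaStrongIsomorphismMultiplicativeProofs
import HarnessLib

/-!
# The comparison `ι_v(θ) = 1` at a multiplicative place of the same twist type from DECIDABLE
# numerals — the `hrel` input of the hybrid witness road at r1's kind-(iii) places
# (team n1011, row T-DIV3L, FILE D9; offered 2026-08-22T00:51Z, first refusal p04 / p18)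

HONEST FRAMING (cell `b2b-bsdres`, run/shared/lean/b2b/bsd-rank1-residual/, verbatim in every
file): the goal of the cell is to DELETE the COMBINATION-SHAPED residual classes of the
Birch–Swinnerton-Dyer formula for ALL analytic-rank `≤ 1` elliptic curves over `ℚ` — "full BSD
formula for every rank `≤ 1` curve in class `C`" assembled STRICTLY from published theorems — so
that the rank-`≤ 1` remainder becomes exactly the CONSTRUCTION-SHAPED classes, which are TYPED
(missing-input `Prop`s), NOT attempted. This is not "finishing BSD". Team n1011 (N10/N11): research
route; this file is a TOOL (assembly of tree theorems with kernel numerals); nothing is booked by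
it; no mark / label moved; X4 stays CONSTRUCTION-SHAPED. THEOREMS only; no definition, no named
fact of ours (the twisted Tate uniformisation `hU2` = registered A41′ is a DISPLAYED hypothesis, as
on the PASS⁺ road), no `sorry`.

## What

The hybrid END `DivisionDecider.exists_sha_ne_zero_of_congr_of_witnessChecks_of_relIndex` (FILE D5)
asks, at the places over `Lrel`, the comparison
`hrel : (𝓢_v E).relIndex (θ_* 𝓢_v E′) = 1`. At a place of r1's kind (iii) — both curves
MULTIPLICATIVE at `v`, of the SAME twist type, with `μ₃(ℚ_v) = 1` — the tree supplies it
(`WeierstrassCurve.relIndex_map_selmerLocalKer_eq_one_of_hasMultiplicativeReductionAt`, Silverman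
ATAEC V.5.2 (c)/5.3/5.4 via the twisted Tate uniformisation `hU2`). This file feeds that theorem
from `decide`-able data on the global minimal models:

* multiplicativity of `W`, `W′` at `v` from `q ∣ Δ_min`, `q ∤ c₄` (tree
  `hasMultiplicativeReductionAt_of_dvd_of_not_dvd`, Silverman VII.5.1(b));
* the twist-class datum `∃ r, ι(−c₄/c₆) = r² · ι(−c₄′/c₆′)` from `sqFlagAt q (N·D) w = true` for the
  reduced fraction `N/D = (−c₄/c₆)/(−c₄′/c₆′)` (T-LOC3L FILE L6 `exists_eq_sq_mul_of_sqFlagAt`);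
* `μ₃(ℚ_v) = 1` from `sqFlagAt q (−3) w₃ = false` (FILE L6
  `forall_pow_three_eq_one_adicCompletion_of_sqFlagAt`).

ENDs: `relIndex_eq_one_of_kindIII_checks` (+ the `…_of_hasMultiplicativeReductionAt` core with the
two reduction facts displayed, and the `integralModelInt`-currency `…_of_intModel`); and for r1's
kind (ii) — both curves SPLIT multiplicative at `v ∤ 3` with `#E(ℚ_v)[3] ≤ 3` —
`relIndex_eq_one_of_kindII_checks_of_intModel`: splitness from a ROOT mod `q` of the node-tangent
quadratic of the integral model (tree `hasSplitMultiplicativeReductionAt_iff_splits` + Mathlib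
`Polynomial.Splits.of_natDegree_eq_two`), the count `#E(ℚ_v)[3] = 1 + 2S ≤ 3` from a T-LOC3L
certificate with `S ≤ 1` (FILE L5), fed into the tree's
`relIndex_map_selmerLocalKer_eq_one_of_hasSplitMultiplicativeReductionAt` (Tate uniformisation `hU`,
displayed). Census (EVIDENCE, `HOME/b2b-bsdres-n1011-p17/gen9/census/
div3_hybrid_places.json`): 320 kind-(iii) places of the 333 hybrid FAIL@3 witness pairs carry these
numerals (281 pairs fully certifiable together with the 115 kind-(ii) places).

References: [SilvermanATAEC1994] V.5.2 (c), 5.3, 5.4; [SilvermanAEC2009] VII.5.1(b);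
[Serre1973] II.3.3; [CremonaMazur2000] §3.
-/

set_option autoImplicit false

noncomputable section

open scoped Classical

open WeierstrassCurve NumberField IsDedekindDomain Rat.HeightOneSpectrum Field
  Literature.NumberTheory.EllipticCurves Literature.NumberTheory.GaloisRepresentations
open Summit.BirchSwinnertonDyer.Rank1Residual.GaloisImage.LocalTorsion3At
  (sqFlagAt threeTorsionCheckAt exists_eq_sq_mul_of_sqFlagAt
    forall_pow_three_eq_one_adicCompletion_of_sqFlagAt
    natCard_ker_nsmul_three_adicCompletion_eq_of_intModel_of_checkAt)

namespace Summit.BirchSwinnertonDyer.Rank1Residual.GaloisImage.DivisionDecider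

section KindIII

variable (q : ℕ) [hq : Fact q.Prime]

/-- **Kind (iii), core: `ι_v(θ) = 1` at a place `v` of the prime `q` where both `3`-congruent
curves are multiplicative, of the same twist class by the decidable flag on `N·D`
(`N/D = (−c₄/c₆)/(−c₄′/c₆′)` reduced), and `μ₃(ℚ_v) = 1` by the flag on `−3`** — the tree's
`relIndex_map_selmerLocalKer_eq_one_of_hasMultiplicativeReductionAt` fed by T-LOC3L FILE L6;
conditional on the twisted Tate uniformisation `hU2` (displayed).
[cite: SilvermanATAEC1994, Ch. V Lemma 5.2 (c), Thm. 5.3, Cor. 5.4] [cite: Serre1973, Ch. II §3.3] -/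
theorem relIndex_eq_one_of_hasMultiplicativeReductionAt_of_sqFlagAt
    (hU2 : Silverman1994_thmV53_corV54_tateUniformisation.{0})
    (W W' : WeierstrassCurve ℚ) [W.IsElliptic] [W'.IsElliptic]
    (θ : geomTorsion W' ((3 : ℕ) : ℤ) ≃+ geomTorsion W ((3 : ℕ) : ℤ))
    (hθ : ∀ (σ : Field.absoluteGaloisGroup ℚ) (P : geomTorsion W' ((3 : ℕ) : ℤ)),
      θ (σ • P) = σ • θ P)
    {v : HeightOneSpectrum (𝓞 ℚ)} (hv : (primesEquiv v : ℕ) = q)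
    (hW : W.HasMultiplicativeReductionAt v) (hW' : W'.HasMultiplicativeReductionAt v)
    (hB : -(W'.c₄ / W'.c₆) ≠ 0) {N D : ℤ} (hD : D ≠ 0)
    (hAB : (-(W.c₄ / W.c₆)) / (-(W'.c₄ / W'.c₆)) = (N : ℚ) / (D : ℚ))
    {w : ℕ} (hw : (q : ℤ) ^ w ∣ N * D) (hw' : ¬ (q : ℤ) ^ (w + 1) ∣ N * D)
    (hflag : sqFlagAt q (N * D) w = true)
    {w₃ : ℕ} (hw₃ : (q : ℤ) ^ w₃ ∣ (-3 : ℤ)) (hw₃' : ¬ (q : ℤ) ^ (w₃ + 1) ∣ (-3 : ℤ))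
    (hflag₃ : sqFlagAt q (-3) w₃ = false) :
    haveI : Fact (Nat.Prime 3) := ⟨Nat.prime_three⟩
    (selmerLocalKer W (v.adicCompletion ℚ) ((3 : ℕ) : ℤ)).relIndex
        ((selmerLocalKer W' (v.adicCompletion ℚ) ((3 : ℕ) : ℤ)).map
          (h1Equiv θ hθ).toAddMonoidHom) = 1 := by
  haveI : Fact (Nat.Prime 3) := ⟨Nat.prime_three⟩
  exact W.relIndex_map_selmerLocalKer_eq_one_of_hasMultiplicativeReductionAt v hU2 (by norm_num)
    W' θ hθ hW hW' (exists_eq_sq_mul_of_sqFlagAt v hv hB hD hAB hw hw' hflag)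
    (forall_pow_three_eq_one_adicCompletion_of_sqFlagAt v hv hw₃ hw₃' hflag₃)

/-- **Kind (iii) from the global minimal models (`hrel` for the hybrid witness END).** As above,
with the two multiplicativity facts DERIVED from `q ∣ Δ_min` and `q ∤ c₄(integral model)` of `W` and
`W′` (tree `hasMultiplicativeReductionAt_of_dvd_of_not_dvd`, Silverman VII.5.1(b)); every remaining
numeral is `decide`-able once the records seat rewrites `integralModelInt`, `c₄`, `c₆` of the two
literal curves. [cite: SilvermanAEC2009, VII.5 Prop. 5.1(b)]
[cite: SilvermanATAEC1994, Ch. V Lemma 5.2 (c), Thm. 5.3, Cor. 5.4] -/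
theorem relIndex_eq_one_of_kindIII_checks
    (hU2 : Silverman1994_thmV53_corV54_tateUniformisation.{0})
    (W W' : WeierstrassCurve ℚ) [W.IsElliptic] [W'.IsElliptic] [W.IsGloballyMinimal]
    [W'.IsGloballyMinimal]
    (θ : geomTorsion W' ((3 : ℕ) : ℤ) ≃+ geomTorsion W ((3 : ℕ) : ℤ))
    (hθ : ∀ (σ : Field.absoluteGaloisGroup ℚ) (P : geomTorsion W' ((3 : ℕ) : ℤ)),
      θ (σ • P) = σ • θ P)
    {v : HeightOneSpectrum (𝓞 ℚ)} (hv : (primesEquiv v : ℕ) = q)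
    (hΔ : (q : ℤ) ∣ minimalDiscriminantInt W) (hc₄ : ¬ (q : ℤ) ∣ (integralModelInt W).c₄)
    (hΔ' : (q : ℤ) ∣ minimalDiscriminantInt W') (hc₄' : ¬ (q : ℤ) ∣ (integralModelInt W').c₄)
    (hB : -(W'.c₄ / W'.c₆) ≠ 0) {N D : ℤ} (hD : D ≠ 0)
    (hAB : (-(W.c₄ / W.c₆)) / (-(W'.c₄ / W'.c₆)) = (N : ℚ) / (D : ℚ))
    {w : ℕ} (hw : (q : ℤ) ^ w ∣ N * D) (hw' : ¬ (q : ℤ) ^ (w + 1) ∣ N * D)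
    (hflag : sqFlagAt q (N * D) w = true)
    {w₃ : ℕ} (hw₃ : (q : ℤ) ^ w₃ ∣ (-3 : ℤ)) (hw₃' : ¬ (q : ℤ) ^ (w₃ + 1) ∣ (-3 : ℤ))
    (hflag₃ : sqFlagAt q (-3) w₃ = false) :
    haveI : Fact (Nat.Prime 3) := ⟨Nat.prime_three⟩
    (selmerLocalKer W (v.adicCompletion ℚ) ((3 : ℕ) : ℤ)).relIndex
        ((selmerLocalKer W' (v.adicCompletion ℚ) ((3 : ℕ) : ℤ)).map
          (h1Equiv θ hθ).toAddMonoidHom) = 1 := by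
  have hqv : ((primesEquiv v : ℕ) : ℤ) = (q : ℤ) := by rw [hv]
  have hWm : W.HasMultiplicativeReductionAt v :=
    W.hasMultiplicativeReductionAt_of_dvd_of_not_dvd v (hqv ▸ hΔ) (hqv ▸ hc₄)
  have hW'm : W'.HasMultiplicativeReductionAt v :=
    W'.hasMultiplicativeReductionAt_of_dvd_of_not_dvd v (hqv ▸ hΔ') (hqv ▸ hc₄')
  exact relIndex_eq_one_of_hasMultiplicativeReductionAt_of_sqFlagAt q hU2 W W' θ hθ hv hWm hW'm hB
    hD hAB hw hw' hflag hw₃ hw₃' hflag₃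

end KindIII

section IntModel

variable (q : ℕ) [hq : Fact q.Prime]

/-- `c₄`, `c₆` of a globally minimal `W/ℚ` are the casts of those of its integer model. [folklore] -/
theorem c₄_eq_intModel (W : WeierstrassCurve ℚ) [W.IsGloballyMinimal] :
    W.c₄ = ((integralModelInt W).c₄ : ℚ) ∧ W.c₆ = ((integralModelInt W).c₆ : ℚ) := by
  constructor
  · conv_lhs => rw [← map_integralModelInt W]
    rw [map_c₄, eq_intCast]
  · conv_lhs => rw [← map_integralModelInt W]
    rw [map_c₆, eq_intCast]

/-- **Kind (iii), `integralModelInt` currency** (route-1 records: `hI : W.integralModelInt = E₀`,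
`hI′`): every numeral is read on the two integer models — `q ∣ Δ(E₀)`, `q ∤ c₄(E₀)` (and for `F₀`),
the twist-class fraction `(−c₄(E₀)/c₆(E₀)) / (−c₄(F₀)/c₆(F₀)) = N/D`, the two square flags.
[cite: SilvermanAEC2009, VII.5 Prop. 5.1(b)] [cite: SilvermanATAEC1994, Ch. V Lemma 5.2 (c), Thm. 5.3, Cor. 5.4] -/
theorem relIndex_eq_one_of_kindIII_checks_of_intModel
    (hU2 : Silverman1994_thmV53_corV54_tateUniformisation.{0})
    (W W' : WeierstrassCurve ℚ) [W.IsElliptic] [W'.IsElliptic] [W.IsGloballyMinimal]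
    [W'.IsGloballyMinimal] {E₀ F₀ : WeierstrassCurve ℤ} (hI : W.integralModelInt = E₀)
    (hI' : W'.integralModelInt = F₀)
    (θ : geomTorsion W' ((3 : ℕ) : ℤ) ≃+ geomTorsion W ((3 : ℕ) : ℤ))
    (hθ : ∀ (σ : Field.absoluteGaloisGroup ℚ) (P : geomTorsion W' ((3 : ℕ) : ℤ)),
      θ (σ • P) = σ • θ P)
    {v : HeightOneSpectrum (𝓞 ℚ)} (hv : (primesEquiv v : ℕ) = q)
    (hΔ : (q : ℤ) ∣ E₀.Δ) (hc₄ : ¬ (q : ℤ) ∣ E₀.c₄) (hΔ' : (q : ℤ) ∣ F₀.Δ) (hc₄' : ¬ (q : ℤ) ∣ F₀.c₄)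
    (hc₄F : F₀.c₄ ≠ 0) (hc₆F : F₀.c₆ ≠ 0) {N D : ℤ} (hD : D ≠ 0)
    (hAB : (-((E₀.c₄ : ℚ) / (E₀.c₆ : ℚ))) / (-((F₀.c₄ : ℚ) / (F₀.c₆ : ℚ))) = (N : ℚ) / (D : ℚ))
    {w : ℕ} (hw : (q : ℤ) ^ w ∣ N * D) (hw' : ¬ (q : ℤ) ^ (w + 1) ∣ N * D)
    (hflag : sqFlagAt q (N * D) w = true)
    {w₃ : ℕ} (hw₃ : (q : ℤ) ^ w₃ ∣ (-3 : ℤ)) (hw₃' : ¬ (q : ℤ) ^ (w₃ + 1) ∣ (-3 : ℤ))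
    (hflag₃ : sqFlagAt q (-3) w₃ = false) :
    haveI : Fact (Nat.Prime 3) := ⟨Nat.prime_three⟩
    (selmerLocalKer W (v.adicCompletion ℚ) ((3 : ℕ) : ℤ)).relIndex
        ((selmerLocalKer W' (v.adicCompletion ℚ) ((3 : ℕ) : ℤ)).map
          (h1Equiv θ hθ).toAddMonoidHom) = 1 := by
  obtain ⟨h4, h6⟩ := c₄_eq_intModel W
  obtain ⟨h4', h6'⟩ := c₄_eq_intModel W'
  rw [hI] at h4 h6
  rw [hI'] at h4' h6'
  have hB : -(W'.c₄ / W'.c₆) ≠ 0 := by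
    rw [h4', h6', neg_ne_zero, div_ne_zero_iff]
    exact ⟨by exact_mod_cast hc₄F, by exact_mod_cast hc₆F⟩
  have hAB' : (-(W.c₄ / W.c₆)) / (-(W'.c₄ / W'.c₆)) = (N : ℚ) / (D : ℚ) := by
    rw [h4, h6, h4', h6']; exact hAB
  refine relIndex_eq_one_of_kindIII_checks q hU2 W W' θ hθ hv ?_ ?_ ?_ ?_ hB hD hAB' hw hw' hflag hw₃
    hw₃' hflag₃
  · rw [minimalDiscriminantInt, hI]; exact hΔ
  · rw [hI]; exact hc₄
  · rw [minimalDiscriminantInt, hI']; exact hΔ'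
  · rw [hI']; exact hc₄'

end IntModel

section KindII

variable (q : ℕ) [hq : Fact q.Prime]

/-- **Split multiplicative reduction from a ROOT CERTIFICATE**: for a globally minimal `W/ℚ` with
integer model `E₀`, `q ∣ Δ(E₀)`, `q ∤ c₄(E₀)`, and a residue `t` with
`c₄ t² + a₁c₄ t − (54 b₆ − 3 b₂ b₄ + a₂ c₄) ≡ 0 (mod q)` (the node-tangent quadratic of `E₀`), `W` is
SPLIT multiplicative at the place of `q` (tree `hasSplitMultiplicativeReductionAt_iff_splits`; a
quadratic with a root splits, Mathlib `Polynomial.Splits.of_natDegree_eq_two`).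
[cite: SilvermanAEC2009, VII.5 Prop. 5.1(b) and VII.1 Prop. 1.3(b)] -/
theorem hasSplitMultiplicativeReductionAt_of_intModel_of_root (W : WeierstrassCurve ℚ) [W.IsElliptic]
    [W.IsGloballyMinimal] {E₀ : WeierstrassCurve ℤ} (hI : W.integralModelInt = E₀)
    {v : HeightOneSpectrum (𝓞 ℚ)} (hv : (primesEquiv v : ℕ) = q)
    (hΔ : (q : ℤ) ∣ E₀.Δ) (hc₄ : ¬ (q : ℤ) ∣ E₀.c₄) (t : ZMod q)
    (ht : (E₀.c₄ : ZMod q) * t ^ 2 + ((E₀.a₁ * E₀.c₄ : ℤ) : ZMod q) * t -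
      ((54 * E₀.b₆ - 3 * E₀.b₂ * E₀.b₄ + E₀.a₂ * E₀.c₄ : ℤ) : ZMod q) = 0) :
    W.HasSplitMultiplicativeReductionAt v := by
  subst hv
  have hΔm : ((primesEquiv v : ℕ) : ℤ) ∣ minimalDiscriminantInt W := by
    rw [minimalDiscriminantInt, hI]; exact hΔ
  have hc₄m : ¬ ((primesEquiv v : ℕ) : ℤ) ∣ (integralModelInt W).c₄ := by rw [hI]; exact hc₄
  rw [W.hasSplitMultiplicativeReductionAt_iff_splits v hΔm hc₄m, hI]
  set I := E₀.map (Int.castRingHom (ZMod (primesEquiv v : ℕ))) with hIdef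
  have hIc₄ : I.c₄ = (E₀.c₄ : ZMod (primesEquiv v : ℕ)) := by rw [hIdef, map_c₄]; simp
  have hc₄0 : I.c₄ ≠ 0 := by
    rw [hIc₄, Ne, ZMod.intCast_zmod_eq_zero_iff_dvd]
    exact hc₄
  -- the node-tangent quadratic has a root, hence splits
  have hshape : Polynomial.C I.c₄ * Polynomial.X ^ 2 + Polynomial.C (I.a₁ * I.c₄) * Polynomial.X -
      Polynomial.C (54 * I.b₆ - 3 * I.b₂ * I.b₄ + I.a₂ * I.c₄) =
      Polynomial.C I.c₄ * Polynomial.X ^ 2 + Polynomial.C (I.a₁ * I.c₄) * Polynomial.X +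
      Polynomial.C (-(54 * I.b₆ - 3 * I.b₂ * I.b₄ + I.a₂ * I.c₄)) := by
    rw [map_neg, sub_eq_add_neg]
  rw [hshape]
  refine Polynomial.Splits.of_natDegree_eq_two (x := t) (Polynomial.natDegree_quadratic hc₄0) ?_
  have e : Polynomial.eval t (Polynomial.C I.c₄ * Polynomial.X ^ 2 +
      Polynomial.C (I.a₁ * I.c₄) * Polynomial.X +
      Polynomial.C (-(54 * I.b₆ - 3 * I.b₂ * I.b₄ + I.a₂ * I.c₄))) =
      (E₀.c₄ : ZMod (primesEquiv v : ℕ)) * t ^ 2 +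
        ((E₀.a₁ * E₀.c₄ : ℤ) : ZMod (primesEquiv v : ℕ)) * t -
        ((54 * E₀.b₆ - 3 * E₀.b₂ * E₀.b₄ + E₀.a₂ * E₀.c₄ : ℤ) : ZMod (primesEquiv v : ℕ)) := by
    simp only [Polynomial.eval_add, Polynomial.eval_mul, Polynomial.eval_C, Polynomial.eval_pow,
      Polynomial.eval_X, hIdef, map_c₄, map_b₂, map_b₄, map_b₆, WeierstrassCurve.map_a₁,
      WeierstrassCurve.map_a₂, eq_intCast]
    push_cast
    ring
  rw [e]; exact ht

/-- **Kind (ii), `integralModelInt` currency: `ι_v(θ) = 1` at a place `v` of a prime `q ≠ 3` where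
both `3`-congruent curves are SPLIT multiplicative (root certificates `t`, `t′` of the two
node-tangent quadratics) and `#E(ℚ_v)[3] ≤ 3` (a T-LOC3L certificate `threeTorsionCheckAt q … = some S`
on `E₀` with `S ≤ 1`, FILE L5)** — the tree's
`relIndex_map_selmerLocalKer_eq_one_of_hasSplitMultiplicativeReductionAt`, conditional on Tate's
uniformisation `hU` (displayed). [cite: SilvermanATAEC1994, Ch. V Thm. 3.1, Thm. 5.3]
[cite: SilvermanAEC2009, VII.5 Prop. 5.1(b) and VII.1 Prop. 1.3(b)] -/
theorem relIndex_eq_one_of_kindII_checks_of_intModel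
    (hU : Silverman1994_thmV53_tateUniformisation.{0})
    (W W' : WeierstrassCurve ℚ) [W.IsElliptic] [W'.IsElliptic] [W.IsGloballyMinimal]
    [W'.IsGloballyMinimal] {a₁ a₂ a₃ a₄ a₆ : ℤ} {F₀ : WeierstrassCurve ℤ}
    (hI : W.integralModelInt = ⟨a₁, a₂, a₃, a₄, a₆⟩) (hI' : W'.integralModelInt = F₀)
    (θ : geomTorsion W' ((3 : ℕ) : ℤ) ≃+ geomTorsion W ((3 : ℕ) : ℤ))
    (hθ : ∀ (σ : Field.absoluteGaloisGroup ℚ) (P : geomTorsion W' ((3 : ℕ) : ℤ)),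
      θ (σ • P) = σ • θ P)
    (hq3 : q ≠ 3) {v : HeightOneSpectrum (𝓞 ℚ)} (hv : (primesEquiv v : ℕ) = q)
    (hΔ : (q : ℤ) ∣ (⟨a₁, a₂, a₃, a₄, a₆⟩ : WeierstrassCurve ℤ).Δ)
    (hc₄ : ¬ (q : ℤ) ∣ (⟨a₁, a₂, a₃, a₄, a₆⟩ : WeierstrassCurve ℤ).c₄)
    (hΔ' : (q : ℤ) ∣ F₀.Δ) (hc₄' : ¬ (q : ℤ) ∣ F₀.c₄) (t t' : ZMod q)
    (ht : letI E₀ : WeierstrassCurve ℤ := ⟨a₁, a₂, a₃, a₄, a₆⟩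
      (E₀.c₄ : ZMod q) * t ^ 2 + ((E₀.a₁ * E₀.c₄ : ℤ) : ZMod q) * t -
        ((54 * E₀.b₆ - 3 * E₀.b₂ * E₀.b₄ + E₀.a₂ * E₀.c₄ : ℤ) : ZMod q) = 0)
    (ht' : (F₀.c₄ : ZMod q) * t' ^ 2 + ((F₀.a₁ * F₀.c₄ : ℤ) : ZMod q) * t' -
        ((54 * F₀.b₆ - 3 * F₀.b₂ * F₀.b₄ + F₀.a₂ * F₀.c₄ : ℤ) : ZMod q) = 0)
    {k S : ℕ} {cert : List (ℤ × ℕ × ℕ × ℕ)} (hS : S ≤ 1)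
    (hcheck : threeTorsionCheckAt q a₁ a₂ a₃ a₄ a₆ k cert = some S) :
    haveI : Fact (Nat.Prime 3) := ⟨Nat.prime_three⟩
    (selmerLocalKer W (v.adicCompletion ℚ) ((3 : ℕ) : ℤ)).relIndex
        ((selmerLocalKer W' (v.adicCompletion ℚ) ((3 : ℕ) : ℤ)).map
          (h1Equiv θ hθ).toAddMonoidHom) = 1 := by
  haveI : Fact (Nat.Prime 3) := ⟨Nat.prime_three⟩
  have hWs := hasSplitMultiplicativeReductionAt_of_intModel_of_root q W hI hv hΔ hc₄ t ht
  have hW's := hasSplitMultiplicativeReductionAt_of_intModel_of_root q W' hI' hv hΔ' hc₄' t' ht'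
  have hcard : Nat.card (nsmulAddMonoidHom 3 : (W.baseChange (v.adicCompletion ℚ)).toAffine.Point →+
      (W.baseChange (v.adicCompletion ℚ)).toAffine.Point).ker ≤ 3 := by
    rw [natCard_ker_nsmul_three_adicCompletion_eq_of_intModel_of_checkAt q a₁ a₂ a₃ a₄ a₆ hq3 W hI
      hcheck hv]
    omega
  exact W.relIndex_map_selmerLocalKer_eq_one_of_hasSplitMultiplicativeReductionAt v hU W' θ hθ hWs
    hW's hcard

end KindII

section Instances

/-- **Instance, kind (iii): `133848bp1 ~ 133848z1` at `q = 11`** (r1 FAIL@3 witness pair; both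
curves non-split multiplicative at `11`, `#E′(ℚ₁₁)[3] = 3`, the witness not `3`-divisible there):
`ι_v(θ) = 1` at the place of `11` from the integer models `E₀ = [0,0,0,−12192843,16387225270]`,
`F₀ = [0,0,0,1014,−340535]` — `11 ∣ Δ`, `11 ∤ c₄` on both, twist-class fraction `24049/96244` a square
unit class at `11`, `μ₃(ℚ₁₁) = 1` (`11 ≡ 2 mod 3`); all numerals by `decide +kernel`; `hU2`, `θ`,
minimality displayed. [folklore] -/
theorem relIndex_eq_one_133848bp1_133848z1_at11
    (hU2 : Silverman1994_thmV53_corV54_tateUniformisation.{0})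
    (W W' : WeierstrassCurve ℚ) [W.IsElliptic] [W'.IsElliptic] [W.IsGloballyMinimal]
    [W'.IsGloballyMinimal] (hI : W.integralModelInt = ⟨0, 0, 0, -12192843, 16387225270⟩)
    (hI' : W'.integralModelInt = ⟨0, 0, 0, 1014, -340535⟩)
    (θ : geomTorsion W' ((3 : ℕ) : ℤ) ≃+ geomTorsion W ((3 : ℕ) : ℤ))
    (hθ : ∀ (σ : Field.absoluteGaloisGroup ℚ) (P : geomTorsion W' ((3 : ℕ) : ℤ)),
      θ (σ • P) = σ • θ P)
    {v : HeightOneSpectrum (𝓞 ℚ)} (hv : (primesEquiv v : ℕ) = 11) :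
    haveI : Fact (Nat.Prime 3) := ⟨Nat.prime_three⟩
    (selmerLocalKer W (v.adicCompletion ℚ) ((3 : ℕ) : ℤ)).relIndex
        ((selmerLocalKer W' (v.adicCompletion ℚ) ((3 : ℕ) : ℤ)).map
          (h1Equiv θ hθ).toAddMonoidHom) = 1 :=
  relIndex_eq_one_of_kindIII_checks_of_intModel 11 (hq := ⟨by norm_num⟩) hU2 W W' hI hI' θ hθ hv
    (by decide +kernel) (by decide +kernel) (by decide +kernel) (by decide +kernel)
    (by decide +kernel) (by decide +kernel) (N := 24049) (D := 96244) (by decide)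
    (by decide +kernel) (w := 0) (by decide +kernel) (by decide +kernel) (by decide +kernel)
    (w₃ := 0) (by decide +kernel) (by decide +kernel) (by decide +kernel)

end Instances

end Summit.BirchSwinnertonDyer.Rank1Residual.GaloisImage.DivisionDecider

end
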